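import Literature.AlgebraicGeometry.Motives.HodgeThetaAnnihilatorUnitaryTimesCMCurve
import HarnessLib

/-!
# Rational tensors on `V₁ ⊕ V₂` killed by `Θ` are killed by `ι₁ 𝔰𝔲_k(V₁, ψ₁)_ℂ π₁` when `V₁` is of unitary type `(m, 1)` and the Hodge endomorphisms of `V₂` have an ABELIAN skew commutant — `V₂` the `H¹` of a power `E²` of a CM elliptic curve, or of any product of CM abelian varieties (Moonen–Zarhin 1999 §5 (5.11), case (e): `Hg(X₁² × X₂) ≅ Hg(X₁ × X₂) ⊇ {1} × SU_{F/k}(V₂, ψ)`, the Lie step)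

Family `hodge`, layer `Literature/AlgebraicGeometry/Motives` (abstract polarizable `ℚ`-Hodge structures; no
geometry). Research context: cell `pub-hodge-ring2` (HONEST FRAMING: research route conditional on HC_CM; not a
corollary; Q11.4-sentence-2 already refuted in dim ≥ 3), Literature lane (lit gen 66), programme R41 «case (e) ∩ (a1):
`E × E × T`, `T` a simple threefold of unitary type `(2,1)` over `k = End⁰(E)`», abstract half. UNCONDITIONAL linear
algebra / Hodge theory; theorems only (no definition, no named fact, D-0026; nothing admitted); no step towards a summit
statement. It GENERALISES the tree's `HodgeThetaAnnihilatorUnitaryTimesCMCurve` (programme R29: `V₂` the `H¹` of ONE CM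
elliptic curve, `dim V₂ = 2`): the only property of `V₂` used there — the `V₂`-corners of the annihilator Lie algebra,
which commute with `φ₂` and are `ψ₂`-skew, lie on the line `ℚφ₂` and hence COMMUTE — is replaced by the hypothesis that
any two `ψ₂`-skew endomorphisms of `V₂` commuting with ALL Hodge endomorphisms of `V₂` commute with each other. This
holds for `V₂ = H¹(E)` (R29), for `V₂ = H¹(E × E)` (`End_Hdg = M₂(k)`, commutant `k`: case (e)), and for the `H¹` of any
abelian variety of CM type (commutant of `End⁰` inside `End_ℚ H¹` is the centre, a product of CM fields).

PRINTED RESULTS, Lie-algebra form. B. Moonen, Yu. Zarhin, *Hodge classes on abelian varieties of low dimension*,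
Math. Ann. 315 (1999) 711–733 [held: `paper:arxiv-math_9901113`]:
* Thm. 0.2 (1) with case (e) (chunk p0001 L129–L131, L148–L158): «(e) The abelian variety `X` is isogenous to a product
  `X₁² × X₂`, where `X₁` and `X₂` are as in (a)» [`X₁` an elliptic curve with `End⁰(X₁) = k`, `X₂` a simple abelian
  threefold with `k ↪ End⁰(X₂)`] «… Then the Hodge ring `B•(X)` is generated by the subalgebra `D•(X)` of divisor
  classes together with the subspaces `W_{k,α}`»;
* §5 (5.11) (chunk p0011 L50–L78): «To settle case (e) it thus remains to compute the Hodge classes in `H² ⊗ H²` …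
  Consider the algebraic `ℚ`-subgroup `SU_{F/k}(V₂,ψ) = Ker(det_k : U_F(V₂,ψ) → U_k)` … Now our description of
  `Hg(X) ≅ Hg(X₁ × X₂)` in (5.3) above shows that `Hg(X) ⊃ {1} × SU_{F/k}(V₂,ψ)`, so that the Hodge classes in
  `H² ⊗ H²` are contained in `H²(X₁²,ℚ) ⊗ B¹(X₂)`»;
* §5 (5.3) (chunk p0009): «`Hg(X) = {(u₁,u₂) ∈ U_k × U_k(V_{X₂},ψ_{X₂}) ∣ u₁ · det_k(u₂) = 1}` in case (a1) … `Hg(X)`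
  maps surjectively onto `Hg(X₂)`»; §3 Lemma (3.6) (chunk p0007): «Assume that the Hodge group `Hg(X₂)` is a
  `ℚ`-simple algebraic torus …» (here only: `Hg` of the CM factor is commutative);
* §2 (2.3) (chunk p0005), Type IV(1,1): «`Hg(X) = U_F(V,ψ)`» — the tree's THEOREM L′
  `UnitaryTheta.mem_spanC_of_commute_of_skew`.
In the tree's infinitesimal language: `hg(T × S) ⊇ 0 ⊕ 𝔰𝔲_k(V_T, ψ) = 0 ⊕ [𝔲_k(V_T,ψ), 𝔲_k(V_T,ψ)]` whenever `S` is an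
abelian variety whose Hodge endomorphisms have an abelian skew commutant on `H¹(S)` (e.g. `S = E × E`).

THIS FILE. SETTING (that of `HodgeThetaAnnihilatorUnitaryTimesCMCurve`): a `ℚ`-space `U = ι₁V₁ ⊕ ι₂V₂`, effective
weight-one Hodge structures `H_U, H₁, H₂` (`ι_i` map pieces into pieces), polarizations `ψ₁, ψ₂`; on `V₁` an imaginary
quadratic structure `φ₁ ∈ End_Hdg(V₁)`, `φ₁² = -d₁ < 0`, `End_Hdg(V₁) = ℚ + ℚφ₁`, of multiplicities `(m, 1)`, `m ≥ 2`; on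
`V₂` the ABELIAN-COMMUTANT hypothesis `hV₂c`: any two endomorphisms of `V₂` commuting with every element of
`End_Hdg(V₂)` and skew for `ψ₂` commute. MAIN RESULT
(`wordDerAt_incl_bracket_proj_eq_zero_of_unitary_times_abelianCommutant`): every rational coefficient tensor `q` on `U`
killed slice by slice by the matrix of `Θ_U` is killed by the matrix of `ι₁ ∘ [Y, Y'] ∘ π₁` for ALL `ψ₁,ℂ`-skew `Y, Y'`
commuting with `φ₁,ℂ` — «`0 ⊕ 𝔰𝔲_k(V₁, ψ₁)_ℂ ⊆ Lie Hg(T × S)_ℂ`» read on tensor invariants. SPECIAL CASE: the R29 theorem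
(`dim V₂ = 2`, `φ₂² = -d₂`; tree `wordDerAt_incl_bracket_proj_eq_zero_of_unitary_times_cmCurve`) is the instance in which
`hV₂c` is supplied by `RankTwoCM.exists_eq_ratCast_smul_of_commute_of_skew` (two `ψ₂`-skew endomorphisms commuting
with `φ₂` both lie on the line `ℚφ₂`); it is not restated here.

PROOF: the R29 proof VERBATIM with the commuting family enlarged to `ι₁aπ₁` (`a ∈ End_Hdg V₁`), `ι₂bπ₂` (ALL
`b ∈ End_Hdg V₂`) and the two projectors: `Θ_U ∈ 𝔞_ℂ` (each `ι₂bπ₂` is a Hodge endomorphism of `U`); the `V₂`-corners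
of `𝔞` commute with every `b ∈ End_Hdg(V₂)` and are `ψ₂`-skew, hence commute pairwise by `hV₂c`; Goursat step, corner
algebra `𝔤 = c₁(𝔞)`, `Θ₁ ∈ 𝔤_ℂ`, THEOREM L′, complex Goursat step.

## References

* [MoonenZarhin1999LowDim] B. Moonen, Yu. Zarhin, Math. Ann. 315 (1999), Thm. 0.2 (1) with case (e), §5 (5.3), (5.11),
  §3 Lemma (3.6), §2 (2.3), §3 (3.1) (held `paper:arxiv-math_9901113` chunks p0001, p0005–p0007, p0009, p0011).
  [cite: MoonenZarhin1999LowDim, §5 (5.11) case (e) and (5.3)]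
* [Deligne1982HodgeCycles] P. Deligne, LNM 900 (1982), I §3 Prop. 3.4 (descent; minimality). [cite: Deligne1982HodgeCycles, I §3 Prop. 3.4]
* [Lombardo2016] D. Lombardo, Ann. Inst. Fourier 66 (2016), Lemma 3.4 (p. 1229) (the Goursat step). [cite: Lombardo2016, Lemma 3.4 (p. 1229)]
* [Ribet1983] K. A. Ribet, Amer. J. Math. 105 (1983), Thm. 3 (`Hg = U` for coprime multiplicities; the tree's L′).
  [cite: Ribet1983, Thm. 3]
-/

noncomputable section

open scoped TensorProduct
open CategoryTheory Module

namespace Literature.AlgebraicGeometry.Motives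

namespace HodgeStructure

open Literature.RepresentationTheory.GeneralLinear

universe u

section Main

variable {U V₁ V₂ : Type u} [AddCommGroup U] [Module ℚ U] [AddCommGroup V₁] [Module ℚ V₁]
  [AddCommGroup V₂] [Module ℚ V₂] [Module.Finite ℚ U] [Module.Finite ℚ V₁] [Module.Finite ℚ V₂]
  [HodgeTensorFacts.{u, u}] {n : ℤ}
variable {M d m : ℕ}

omit [Module.Finite ℚ U] [Module.Finite ℚ V₁] [Module.Finite ℚ V₂] [HodgeTensorFacts.{u, u}] in
/-- Complexification of a sum of bilinear forms, evaluated (a copy of the private lemma of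
`HodgeThetaAnnihilatorTimesRankOneTorus`). [folklore] -/
private theorem baseChange_add_apply₄ (B B' : LinearMap.BilinForm ℚ U) (x y : ℂ ⊗[ℚ] U) :
    LinearMap.BilinForm.baseChange ℂ (B + B') x y =
      LinearMap.BilinForm.baseChange ℂ B x y + LinearMap.BilinForm.baseChange ℂ B' x y := by
  induction x using TensorProduct.induction_on with
  | zero => simp
  | tmul c v =>
    induction y using TensorProduct.induction_on with
    | zero => simp
    | tmul d w =>
      simp only [LinearMap.BilinForm.baseChange_tmul, LinearMap.add_apply, add_smul]
    | add y y' hy hy' => rw [map_add, map_add, map_add, hy, hy']; abel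
  | add x x' hx hx' =>
    rw [map_add, LinearMap.add_apply, map_add, map_add, LinearMap.add_apply, LinearMap.add_apply, hx, hx']
    abel

/-- **Theorem (Moonen–Zarhin 1999 §5 (5.11) case (e) / (5.3), Lie step, word model): the derived part
`0 ⊕ 𝔰𝔲_k(V₁, ψ₁)` of `Lie Hg(T × S)` for `T` of unitary type `(m, 1)` and `S` with ABELIAN skew commutant of its Hodge
endomorphisms** (`S = E`, `E × E`, or any abelian variety of CM type). Let `U = ι₁V₁ ⊕ ι₂V₂` be a presentation
compatible with effective weight-one Hodge structures `H_U, H₁, H₂`, polarizations `ψ₁, ψ₂`; `φ₁ ∈ End_Hdg(V₁)` with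
`φ₁² = -d₁ < 0`, `End_Hdg(V₁) = ℚ + ℚφ₁` and multiplicities `dim(W_μ ∩ V₁^{0,1}) = 1`, `dim(W_μ ∩ V₁^{1,0}) ≥ 2`
(`μ² = -d₁`); on `V₂`: any two `ψ₂`-skew endomorphisms commuting with all of `End_Hdg(V₂)` commute (`hV₂c`). Then every
RATIONAL coefficient tensor `q` on `U` killed slice by slice by the matrix of `Θ_U` is killed by the matrix of
`ι₁ ∘ (Y Y' - Y' Y) ∘ π₁` for all `Y, Y' ∈ End_ℂ(V₁,ℂ)` commuting with `φ₁,ℂ` and `ψ₁,ℂ`-skew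
(`Y, Y' ∈ 𝔲_k(V₁, ψ₁)_ℂ ≅ 𝔤𝔩(W)`): «`Hg(X) ⊃ {1} × SU_{F/k}(V₂,ψ)`» read on tensor invariants. Proof: the corner algebra
`𝔤 = c₁(annLie q)` is a rational Lie algebra containing `Θ₁` after complexification (Goursat step: the `V₂`-corners
commute by `hV₂c`), so `𝔤_ℂ = 𝔲_k(V₁,ψ₁)_ℂ` by THEOREM L′ and `ι₁[𝔤_ℂ, 𝔤_ℂ]π₁ ⊆ (annLie q)_ℂ`.
[cite: MoonenZarhin1999LowDim, §5 (5.11) case (e) and (5.3)] [cite: MoonenZarhin1999LowDim, §2 (2.3) and §3 (3.1)]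
[cite: Deligne1982HodgeCycles, I §3 Prop. 3.4] [cite: Lombardo2016, Lemma 3.4 (p. 1229)] [cite: Ribet1983, Thm. 3] -/
theorem wordDerAt_incl_bracket_proj_eq_zero_of_unitary_times_abelianCommutant (hn : n = 1) (HU : HodgeStructure U n)
    (H₁ : HodgeStructure V₁ n) (H₂ : HodgeStructure V₂ n) (heff₁ : H₁.IsEffective)
    {ι₁ : V₁ →ₗ[ℚ] U} {π₁ : U →ₗ[ℚ] V₁} {ι₂ : V₂ →ₗ[ℚ] U} {π₂ : U →ₗ[ℚ] V₂}
    (hπι₁ : π₁ ∘ₗ ι₁ = LinearMap.id) (hπι₂ : π₂ ∘ₗ ι₂ = LinearMap.id) (hπ₁ι₂ : π₁ ∘ₗ ι₂ = 0)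
    (hπ₂ι₁ : π₂ ∘ₗ ι₁ = 0) (hsum : ι₁ ∘ₗ π₁ + ι₂ ∘ₗ π₂ = LinearMap.id)
    (hι₁F : ∀ p, ∀ x ∈ H₁.piece p (n - p), ι₁.baseChange ℂ x ∈ HU.piece p (n - p))
    (hι₂F : ∀ p, ∀ x ∈ H₂.piece p (n - p), ι₂.baseChange ℂ x ∈ HU.piece p (n - p))
    (ψ₁ : H₁.Polarization) (ψ₂ : H₂.Polarization)
    {φ₁ : Module.End ℚ V₁} (hφ₁E : φ₁ ∈ H₁.endAlg) {d₁ : ℚ} (hd₁ : 0 < d₁) (hφ₁ : φ₁ * φ₁ = -(d₁ • 1))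
    (hE₁ : ∀ a ∈ H₁.endAlg, ∃ x y : ℚ, a = x • 1 + y • φ₁)
    {μ : ℂ} (hμ : μ ^ 2 = -(d₁ : ℂ))
    (h1 : Module.finrank ℂ ↥(Module.End.eigenspace (φ₁.baseChange ℂ) μ ⊓ H₁.piece 0 1) = 1)
    (h2 : 2 ≤ Module.finrank ℂ ↥(Module.End.eigenspace (φ₁.baseChange ℂ) μ ⊓ H₁.piece 1 0))
    (hV₂c : ∀ Z Z' : Module.End ℚ V₂,
      (∀ b : H₂.endAlg, Z * (b : Module.End ℚ V₂) = (b : Module.End ℚ V₂) * Z) →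
      (∀ v w, ψ₂.form (Z v) w + ψ₂.form v (Z w) = 0) →
      (∀ b : H₂.endAlg, Z' * (b : Module.End ℚ V₂) = (b : Module.End ℚ V₂) * Z') →
      (∀ v w, ψ₂.form (Z' v) w + ψ₂.form v (Z' w) = 0) → Z * Z' = Z' * Z)
    (eQ : Module.Basis (Fin M) ℚ U) (q : (Fin d → Fin m × Fin M) → ℚ)
    {ΘU : Module.End ℂ (ℂ ⊗[ℚ] U)} (hΘU : ∀ p, ∀ x ∈ HU.piece p (n - p), ΘU x = ((2 * p - n : ℤ) : ℂ) • x)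
    {Θ₁ : Module.End ℂ (ℂ ⊗[ℚ] V₁)} (hΘ₁ : ∀ p, ∀ x ∈ H₁.piece p (n - p), Θ₁ x = ((2 * p - n : ℤ) : ℂ) • x)
    {Θ₂ : Module.End ℂ (ℂ ⊗[ℚ] V₂)} (hΘ₂ : ∀ p, ∀ x ∈ H₂.piece p (n - p), Θ₂ x = ((2 * p - n : ℤ) : ℂ) • x)
    (hΘq : ∀ u : Fin d → Fin m, wordDerAt ℂ (fun _ : Fin d =>
      LinearMap.toMatrix (Algebra.TensorProduct.basis ℂ eQ) (Algebra.TensorProduct.basis ℂ eQ) ΘU)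
      (wordSlice (fun w => algebraMap ℚ ℂ (q w)) u) = 0)
    {Y Y' : Module.End ℂ (ℂ ⊗[ℚ] V₁)} (hYφ : Y * φ₁.baseChange ℂ = φ₁.baseChange ℂ * Y)
    (hYskew : ∀ x y, ψ₁.form.baseChange ℂ (Y x) y + ψ₁.form.baseChange ℂ x (Y y) = 0)
    (hY'φ : Y' * φ₁.baseChange ℂ = φ₁.baseChange ℂ * Y')
    (hY'skew : ∀ x y, ψ₁.form.baseChange ℂ (Y' x) y + ψ₁.form.baseChange ℂ x (Y' y) = 0)
    (u : Fin d → Fin m) :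
    wordDerAt ℂ (fun _ : Fin d =>
      LinearMap.toMatrix (Algebra.TensorProduct.basis ℂ eQ) (Algebra.TensorProduct.basis ℂ eQ)
        (ι₁.baseChange ℂ ∘ₗ (Y * Y' - Y' * Y) ∘ₗ π₁.baseChange ℂ))
      (wordSlice (fun w => algebraMap ℚ ℂ (q w)) u) = 0 := by
  classical
  have hΘ₁C : Θ₁ ∈ H₁.hodgeLieC := H₁.mem_hodgeLieC_of_forall_piece hΘ₁
  have hΘ₂C : Θ₂ ∈ H₂.hodgeLieC := H₂.mem_hodgeLieC_of_forall_piece hΘ₂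
  have hsum' : ι₂ ∘ₗ π₂ + ι₁ ∘ₗ π₁ = LinearMap.id := by rw [add_comm]; exact hsum
  -- pointwise slot identities
  have e11 : ∀ v, π₁ (ι₁ v) = v := fun v => by
    rw [← LinearMap.comp_apply (f := π₁), hπι₁, LinearMap.id_apply]
  have e22 : ∀ w, π₂ (ι₂ w) = w := fun w => by
    rw [← LinearMap.comp_apply (f := π₂), hπι₂, LinearMap.id_apply]
  have e12 : ∀ w, π₁ (ι₂ w) = 0 := fun w => by
    rw [← LinearMap.comp_apply (f := π₁), hπ₁ι₂, LinearMap.zero_apply]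
  have e21 : ∀ v, π₂ (ι₁ v) = 0 := fun v => by
    rw [← LinearMap.comp_apply (f := π₂), hπ₂ι₁, LinearMap.zero_apply]
  -- `Θ` through the presentation
  have hΘι₁ := theta_incl_eq HU H₁ hι₁F hΘU hΘ₁
  have hΘι₂ := theta_incl_eq HU H₂ hι₂F hΘU hΘ₂
  have hΘπ₁ := proj_theta_eq HU H₁ H₂ hπι₁ hπ₁ι₂ hsum hι₁F hι₂F hΘU hΘ₁ hΘ₂
  have hΘπ₂ := proj_theta_eq HU H₂ H₁ hπι₂ hπ₂ι₁ hsum' hι₂F hι₁F hΘU hΘ₂ hΘ₁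
  -- the commuting family: `ι₁ a π₁` (`a ∈ End_Hdg V₁`), `ι₂ b π₂` (ALL `b ∈ End_Hdg V₂`), the two projectors
  set aF : (H₁.endAlg ⊕ H₂.endAlg) ⊕ (Unit ⊕ Unit) → Module.End ℚ U :=
    Sum.elim (Sum.elim (fun a => ι₁ ∘ₗ (a : Module.End ℚ V₁) ∘ₗ π₁) (fun b => ι₂ ∘ₗ (b : Module.End ℚ V₂) ∘ₗ π₂))
      (Sum.elim (fun _ => ι₁ ∘ₗ π₁) (fun _ => ι₂ ∘ₗ π₂)) with haF
  set φ : LinearMap.BilinForm ℚ U := ψ₁.form.compl₁₂ π₁ π₁ + ψ₂.form.compl₁₂ π₂ π₂ with hφ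
  have hφC : ∀ x y, φ.baseChange ℂ x y = ψ₁.form.baseChange ℂ (π₁.baseChange ℂ x) (π₁.baseChange ℂ y) +
      ψ₂.form.baseChange ℂ (π₂.baseChange ℂ x) (π₂.baseChange ℂ y) := fun x y => by
    rw [hφ, baseChange_add_apply₄, baseChange_compl₁₂_apply, baseChange_compl₁₂_apply]
  have hφapply : ∀ x y, φ x y = ψ₁.form (π₁ x) (π₁ y) + ψ₂.form (π₂ x) (π₂ y) := fun x y => by
    rw [hφ, LinearMap.add_apply, LinearMap.add_apply, LinearMap.compl₁₂_apply, LinearMap.compl₁₂_apply]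
  set 𝔞 : Submodule ℚ (Module.End ℚ U) := annLie φ eQ aF q with h𝔞
  -- `Θ_U ∈ 𝔞_ℂ`
  have hΘ𝔞 : ΘU ∈ spanC 𝔞 := by
    refine mem_spanC_annLie φ eQ aF q hΘq (fun i => ?_) (fun x y => ?_)
    · apply LinearMap.ext
      intro y
      rcases i with (a | b) | (_ | _)
      · change ΘU ((ι₁ ∘ₗ (a : Module.End ℚ V₁) ∘ₗ π₁).baseChange ℂ y) =
          (ι₁ ∘ₗ (a : Module.End ℚ V₁) ∘ₗ π₁).baseChange ℂ (ΘU y)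
        simp only [LinearMap.baseChange_comp, LinearMap.comp_apply]
        rw [hΘι₁, ← Module.End.mul_apply (f := Θ₁), commute_baseChange_of_mem_hodgeLieC H₁ hΘ₁C a,
          Module.End.mul_apply, hΘπ₁]
      · change ΘU ((ι₂ ∘ₗ (b : Module.End ℚ V₂) ∘ₗ π₂).baseChange ℂ y) =
          (ι₂ ∘ₗ (b : Module.End ℚ V₂) ∘ₗ π₂).baseChange ℂ (ΘU y)
        simp only [LinearMap.baseChange_comp, LinearMap.comp_apply]
        rw [hΘι₂, ← Module.End.mul_apply (f := Θ₂), commute_baseChange_of_mem_hodgeLieC H₂ hΘ₂C b,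
          Module.End.mul_apply, hΘπ₂]
      · change ΘU ((ι₁ ∘ₗ π₁).baseChange ℂ y) = (ι₁ ∘ₗ π₁).baseChange ℂ (ΘU y)
        simp only [LinearMap.baseChange_comp, LinearMap.comp_apply]
        rw [hΘι₁, hΘπ₁]
      · change ΘU ((ι₂ ∘ₗ π₂).baseChange ℂ y) = (ι₂ ∘ₗ π₂).baseChange ℂ (ΘU y)
        simp only [LinearMap.baseChange_comp, LinearMap.comp_apply]
        rw [hΘι₂, hΘπ₂]
    · rw [hφC, hφC, hΘπ₁, hΘπ₁, hΘπ₂, hΘπ₂, formBaseChange_skew_of_mem_hodgeLieC ψ₁ hΘ₁C,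
        formBaseChange_skew_of_mem_hodgeLieC ψ₂ hΘ₂C]
      ring
  -- what membership in `𝔞` gives
  have hmem : ∀ X ∈ 𝔞, (∀ i, X * aF i = aF i * X) ∧ ∀ v w, φ (X v) w + φ v (X w) = 0 :=
    fun X hX => ((mem_annLie_iff φ eQ aF q X).1 hX).2
  have hP₁ : ∀ X ∈ 𝔞, X * (ι₁ ∘ₗ π₁) = (ι₁ ∘ₗ π₁) * X := fun X hX => (hmem X hX).1 (Sum.inr (Sum.inl ()))
  have hP₂ : ∀ X ∈ 𝔞, X * (ι₂ ∘ₗ π₂) = (ι₂ ∘ₗ π₂) * X := fun X hX => (hmem X hX).1 (Sum.inr (Sum.inr ()))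
  have hTa : ∀ X ∈ 𝔞, ∀ a : H₁.endAlg, X * (ι₁ ∘ₗ (a : Module.End ℚ V₁) ∘ₗ π₁) =
      (ι₁ ∘ₗ (a : Module.End ℚ V₁) ∘ₗ π₁) * X := fun X hX a => (hmem X hX).1 (Sum.inl (Sum.inl a))
  have hTb : ∀ X ∈ 𝔞, ∀ b : H₂.endAlg, X * (ι₂ ∘ₗ (b : Module.End ℚ V₂) ∘ₗ π₂) =
      (ι₂ ∘ₗ (b : Module.End ℚ V₂) ∘ₗ π₂) * X := fun X hX b => (hmem X hX).1 (Sum.inl (Sum.inr b))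
  -- the corners commute with `End_Hdg(V₁)` resp. `End_Hdg(V₂)`, and are skew
  have hc₁comm : ∀ X ∈ 𝔞, ∀ a : H₁.endAlg, (π₁ ∘ₗ X ∘ₗ ι₁) * (a : Module.End ℚ V₁) =
      (a : Module.End ℚ V₁) * (π₁ ∘ₗ X ∘ₗ ι₁) := by
    intro X hX a
    apply LinearMap.ext
    intro v
    have h := congrArg (fun f : Module.End ℚ U => π₁ (f (ι₁ v))) (hTa X hX a)
    simp only [Module.End.mul_apply, LinearMap.comp_apply, e11] at h
    simp only [Module.End.mul_apply, LinearMap.comp_apply]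
    exact h
  have hc₂comm : ∀ X ∈ 𝔞, ∀ b : H₂.endAlg, (π₂ ∘ₗ X ∘ₗ ι₂) * (b : Module.End ℚ V₂) =
      (b : Module.End ℚ V₂) * (π₂ ∘ₗ X ∘ₗ ι₂) := by
    intro X hX b
    apply LinearMap.ext
    intro w
    have h := congrArg (fun g : Module.End ℚ U => π₂ (g (ι₂ w))) (hTb X hX b)
    simp only [Module.End.mul_apply, LinearMap.comp_apply, e22] at h
    simp only [Module.End.mul_apply, LinearMap.comp_apply]
    exact h
  have hc₁skew : ∀ X ∈ 𝔞, ∀ v w, ψ₁.form ((π₁ ∘ₗ X ∘ₗ ι₁) v) w + ψ₁.form v ((π₁ ∘ₗ X ∘ₗ ι₁) w) = 0 := by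
    intro X hX v w
    have h := (hmem X hX).2 (ι₁ v) (ι₁ w)
    rw [apply_incl_eq_of_commute_projector hπι₁ (hP₁ X hX) v,
      apply_incl_eq_of_commute_projector hπι₁ (hP₁ X hX) w, hφapply, hφapply] at h
    simp only [e11, e21, map_zero, add_zero] at h
    simpa only [LinearMap.comp_apply] using h
  have hc₂skew : ∀ X ∈ 𝔞, ∀ v w, ψ₂.form ((π₂ ∘ₗ X ∘ₗ ι₂) v) w + ψ₂.form v ((π₂ ∘ₗ X ∘ₗ ι₂) w) = 0 := by
    intro X hX v w
    have h := (hmem X hX).2 (ι₂ v) (ι₂ w)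
    rw [apply_incl_eq_of_commute_projector hπι₂ (hP₂ X hX) v,
      apply_incl_eq_of_commute_projector hπι₂ (hP₂ X hX) w, hφapply, hφapply] at h
    simp only [e22, e12, map_zero, zero_add] at h
    simpa only [LinearMap.comp_apply] using h
  -- NEW: the `V₂`-corners commute pairwise (abelian skew commutant)
  have hc₂c : ∀ X ∈ 𝔞, ∀ X' ∈ 𝔞,
      (π₂ ∘ₗ X ∘ₗ ι₂) * (π₂ ∘ₗ X' ∘ₗ ι₂) = (π₂ ∘ₗ X' ∘ₗ ι₂) * (π₂ ∘ₗ X ∘ₗ ι₂) := fun X hX X' hX' =>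
    hV₂c _ _ (hc₂comm X hX) (hc₂skew X hX) (hc₂comm X' hX') (hc₂skew X' hX')
  -- the Goursat step inside `𝔞`
  have hbr𝔞 : ∀ X ∈ 𝔞, ∀ X' ∈ 𝔞,
      ι₁ ∘ₗ ((π₁ ∘ₗ X ∘ₗ ι₁) * (π₁ ∘ₗ X' ∘ₗ ι₁) - (π₁ ∘ₗ X' ∘ₗ ι₁) * (π₁ ∘ₗ X ∘ₗ ι₁)) ∘ₗ π₁ ∈ 𝔞 := by
    intro X hX X' hX'
    rw [← bracket_eq_incl_corner_bracket_proj hπι₁ hπι₂ hsum (hP₁ X hX) (hP₂ X hX) (hP₁ X' hX') (hP₂ X' hX')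
      (hc₂c X hX X' hX')]
    exact commutator_mem_annLie φ eQ aF q hX hX'
  -- the corner algebra `𝔤 = c₁(𝔞)`
  obtain ⟨cLin, hcLin⟩ : ∃ L : Module.End ℚ U →ₗ[ℚ] Module.End ℚ V₁, ∀ X, L X = π₁ ∘ₗ X ∘ₗ ι₁ :=
    ⟨{ toFun := fun X => π₁ ∘ₗ X ∘ₗ ι₁
       map_add' := fun X X' => by rw [LinearMap.add_comp, LinearMap.comp_add]
       map_smul' := fun c X => by rw [LinearMap.smul_comp, LinearMap.comp_smul, RingHom.id_apply] },
      fun X => rfl⟩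
  set 𝔤 : Submodule ℚ (Module.End ℚ V₁) := 𝔞.map cLin with h𝔤
  have h𝔤mem : ∀ {Z}, Z ∈ 𝔤 ↔ ∃ X ∈ 𝔞, π₁ ∘ₗ X ∘ₗ ι₁ = Z := by
    intro Z
    rw [h𝔤, Submodule.mem_map]
    simp only [hcLin]
  have hbr𝔤 : ∀ Z ∈ 𝔤, ∀ Z' ∈ 𝔤, Z * Z' - Z' * Z ∈ 𝔤 := by
    intro Z hZ Z' hZ'
    obtain ⟨X, hX, rfl⟩ := h𝔤mem.1 hZ
    obtain ⟨X', hX', rfl⟩ := h𝔤mem.1 hZ'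
    refine h𝔤mem.2 ⟨_, hbr𝔞 X hX X' hX', ?_⟩
    apply LinearMap.ext
    intro v
    simp only [LinearMap.comp_apply, LinearMap.sub_apply, Module.End.mul_apply, e11]
  have hcomm𝔤 : ∀ Z ∈ 𝔤, ∀ a : H₁.endAlg, Z * (a : Module.End ℚ V₁) = (a : Module.End ℚ V₁) * Z := by
    intro Z hZ a
    obtain ⟨X, hX, rfl⟩ := h𝔤mem.1 hZ
    exact hc₁comm X hX a
  have hskew𝔤 : ∀ Z ∈ 𝔤, ∀ v w, ψ₁.form (Z v) w + ψ₁.form v (Z w) = 0 := by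
    intro Z hZ v w
    obtain ⟨X, hX, rfl⟩ := h𝔤mem.1 hZ
    exact hc₁skew X hX v w
  have hspanC𝔤 : spanC 𝔤 = Submodule.span ℂ
      ((fun X : Module.End ℚ U => (π₁ ∘ₗ X ∘ₗ ι₁).baseChange ℂ) '' (𝔞 : Set _)) := by
    rw [spanC, h𝔤, Submodule.map_coe, Set.image_image]
    simp only [hcLin]
  -- `Θ₁ = c₁(Θ_U) ∈ 𝔤_ℂ`
  have hcorner : ∀ T ∈ spanC 𝔞, π₁.baseChange ℂ ∘ₗ T ∘ₗ ι₁.baseChange ℂ ∈ spanC 𝔤 := by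
    intro T hT
    induction hT using Submodule.span_induction with
    | mem Z hZ =>
      obtain ⟨X, hX, rfl⟩ := hZ
      rw [← LinearMap.baseChange_comp, ← LinearMap.baseChange_comp]
      exact baseChange_mem_spanC (h𝔤mem.2 ⟨X, hX, rfl⟩)
    | zero => rw [LinearMap.zero_comp, LinearMap.comp_zero]; exact Submodule.zero_mem _
    | add Z Z' _ _ hZ hZ' => rw [LinearMap.add_comp, LinearMap.comp_add]; exact Submodule.add_mem _ hZ hZ'
    | smul c Z _ hZ => rw [LinearMap.smul_comp, LinearMap.comp_smul]; exact Submodule.smul_mem _ c hZ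
  have hΘ₁𝔤 : Θ₁ ∈ spanC 𝔤 := by
    have h : Θ₁ = π₁.baseChange ℂ ∘ₗ ΘU ∘ₗ ι₁.baseChange ℂ := by
      apply LinearMap.ext
      intro x
      rw [LinearMap.comp_apply, LinearMap.comp_apply, hΘι₁, proj_incl_baseChange hπι₁]
    rw [h]
    exact hcorner ΘU hΘ𝔞
  -- by THEOREM L′ the corner algebra is all of `𝔲_k(V₁, ψ₁)` after complexification: `Y, Y' ∈ 𝔤_ℂ`
  have hY𝔤 : Y ∈ spanC 𝔤 :=
    UnitaryTheta.mem_spanC_of_commute_of_skew H₁ hn heff₁ ψ₁ hφ₁E hd₁ hφ₁ hE₁ hμ h1 h2 𝔤 hbr𝔤 hΘ₁ hΘ₁𝔤 hcomm𝔤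
      hskew𝔤 hYφ hYskew
  have hY'𝔤 : Y' ∈ spanC 𝔤 :=
    UnitaryTheta.mem_spanC_of_commute_of_skew H₁ hn heff₁ ψ₁ hφ₁E hd₁ hφ₁ hE₁ hμ h1 h2 𝔤 hbr𝔤 hΘ₁ hΘ₁𝔤 hcomm𝔤
      hskew𝔤 hY'φ hY'skew
  -- the complex Goursat step: `ι₁ [Y, Y'] π₁ ∈ 𝔞_ℂ`
  have hgoal : ι₁.baseChange ℂ ∘ₗ (Y * Y' - Y' * Y) ∘ₗ π₁.baseChange ℂ ∈ spanC 𝔞 := by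
    rw [hspanC𝔤] at hY𝔤 hY'𝔤
    exact incl_bracket_proj_mem_spanC 𝔞 hbr𝔞 hY𝔤 hY'𝔤
  exact wordDerAt_eq_zero_of_mem_spanC_annLie φ eQ aF q hgoal u

end Main

end HodgeStructure

end Literature.AlgebraicGeometry.Motives

end
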